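import Mathlib
import HarnessLib.Audit
import Summits.PneNP.PneNP.Theorems.PstarCrossCaseP
import Summits.PneNP.PneNP.Theorems.PstarForcing
import Summits.PneNP.PneNP.Theorems.PstarRankRigidityFour

/-!
# The blind free CROSS gate, regime U2 (node N4): one real chord read independently — both state-free parts are constant on `Z(u_{e₀})`, and their single-quadric classification (O2 / E1; prover-1 g22)

FRONTIER range-avoidance ladder, rung F-N3 (`stmt-PneNP-19007`), cell `pnp-ideate`; restricted-model proof complexity — nothing here bears on `P` versus `NP`.

Node N4 (`PstarCrossNodes.CrossU2`): the only real chord besides the gate chords is `e₀`, read by both constraints with independent constant vectors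
`r, r'` (`≠ 0`, `r ≠ r'`), corner-forced (`u_p = u_q = 0 ⟹ u_{e₀} = 1`).  Pointwise sumset:

* **`F_of_killable`** — at a base point where `e₀` is OFF (`u_{e₀} = 0`; then `u_p ∨ u_q = 1` and the virtual chord is ON), the three killed states of `e₀`
  offer `F + (1,0) + {0, r, r'}`, so the target is the fourth vector: **`F(a) = t + (1,0) + r + r'`** — BOTH `q_{(1,0)}` and `q_{(0,1)}` are CONSTANT on
  `Z(u_{e₀})` (`qDir10_of_killable`, `qDir01_of_killable`);
* `qDir10_on_corner` — on the corner the free virtual bit forces `q_{(1,0)} = (r + r')₂ + 1`;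
* `off_of_forced` — where `u_{e₀} = 1` and `u_p ∨ u_q = 1`: `F + (1,0) + r + r' ≠ t`;
* **`qDir_cases`** — `PstarRankRigidityFour.classification` against `u_{e₀} = γ + Q_{D e₀}` (rank `≥ 4`, `PstarChordBridgeForcing.rank_four_of_wf`):
  each of `q_{(1,0)} + κ₂`, `q_{(0,1)} + κ₁` is `0`, `u_{e₀}`, or (up to adding `u_{e₀}`) a product of two affine functions (the NOR row is excluded by
  `PstarForcing.not_rank_four_of_mul`).
The CLEAN sub-cases (`0` / `u_{e₀}` for both) read no AND variable of a private tree edge and die by the budget; the product rows are the residual pins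
(next file).
-/

set_option linter.dupNamespace false -- `Summit.PneNP.PneNP.…`: summit = sub-problem name (D-0017 single-conjunct layout)

open Finset Module Literature.Computability.Complexity
open Summit.PneNP.PneNP.Theorems.PstarFibrePolys (bit)
open Summit.PneNP.PneNP.Theorems.PstarTyped (Typed)
open Summit.PneNP.PneNP.Theorems.PstarSALevel (varSet BoundaryExpanding SimpleOverlap)
open Summit.PneNP.PneNP.Theorems.PstarCubeIdeals (IsAffineFn IsQuadFn)
open Summit.PneNP.PneNP.Theorems.PstarQuadRank (rad)
open Summit.PneNP.PneNP.Theorems.PstarProductRank (qform polar)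
open Summit.PneNP.PneNP.Theorems.PstarReadSumset (V2 span_two)
open Summit.PneNP.PneNP.Theorems.PstarChordSystem (ChordSystem)
open Summit.PneNP.PneNP.Theorems.PstarChordBridgeTools
open Summit.PneNP.PneNP.Theorems.PstarChordBridge
open Summit.PneNP.PneNP.Theorems.PstarChordBridgeForcing (gam sys_u_eq qform_add' rank_four_of_wf)
open Summit.PneNP.PneNP.Theorems.PstarChordBridgeBasis (qDir polarDir)
open Summit.PneNP.PneNP.Theorems.PstarChordBridgeCorner (qDir_add)
open Summit.PneNP.PneNP.Theorems.PstarForcing (exists_ne_of_rank_four not_rank_four_of_mul)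
open Summit.PneNP.PneNP.Theorems.PstarRankRigidityFour (classification)
open Summit.PneNP.PneNP.Theorems.PstarCrossData (CrossData)
open Summit.PneNP.PneNP.Theorems.PstarCrossSystem
open Summit.PneNP.PneNP.Theorems.PstarCrossCaseP (qDir10_eq qDir01_eq)

namespace Summit.PneNP.PneNP.Theorems.PstarCrossCaseU2

variable {n m : ℕ}

section

variable (I : LocalMap 4 n m) {r : ℕ} {B : BridgeData n m} {e_p e_q g₀ : Fin m}

/-- The value of the virtual system on `N₁ = {e₀, e_p}`. -/
theorem val_pair (hD : CrossData I r B e_p e_q g₀) {e₀ : Fin m} (hE : (B.N.erase e_q).erase e_p = {e₀}) (a : Fin n → ZMod 2)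
    (s : Fin m → ZMod 2 × ZMod 2) :
    ((sys I B).vsys e_p e_q).val (B.N.erase e_q) a s =
      (sys I B).F a + (s e_p).1 • ((1, 0) : V2) + ((s e₀).1 • ((sys I B).vsys e_p e_q).ρ e₀ a + (s e₀).2 • ((sys I B).vsys e_p e_q).ρ' e₀ a) := by
  have hpe : e_p ∈ B.N.erase e_q := mem_erase.2 ⟨hD.ne, hD.mem_p⟩
  rw [((sys I B).vsys e_p e_q).val_eq hpe, hE]
  unfold ChordSystem.val ChordSystem.contrib
  rw [sum_singleton, (vsys_reads_p I hD a).1, (vsys_reads_p I hD a).2, smul_zero, add_zero, ChordSystem.vsys_F]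
  abel

/-- **`e₀` OFF ⟹ `F = t + (1,0) + r + r'`.** -/
theorem F_of_killable (hI : I.IsPure xorAndPred) (hT : Typed I) (hD : CrossData I r B e_p e_q g₀) {e₀ : Fin m} (hE : (B.N.erase e_q).erase e_p = {e₀})
    (h1 : ((sys I B).vsys e_p e_q).ρ e₀ 0 ≠ 0) (h2 : ((sys I B).vsys e_p e_q).ρ' e₀ 0 ≠ 0)
    (h3 : ((sys I B).vsys e_p e_q).ρ e₀ 0 ≠ ((sys I B).vsys e_p e_q).ρ' e₀ 0)
    (hcorner : ∀ a, (sys I B).u e_p a = 0 → (sys I B).u e_q a = 0 → (sys I B).u e₀ a = 1)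
    {a : Fin n → ZMod 2} (ha : (sys I B).u e₀ a = 0) :
    (sys I B).F a + (((1, 0) : V2) + (((sys I B).vsys e_p e_q).ρ e₀ 0 + ((sys I B).vsys e_p e_q).ρ' e₀ 0)) = (sys I B).t := by
  classical
  set V := (sys I B).vsys e_p e_q with hV
  have he₀ : e₀ ∈ (B.N.erase e_q).erase e_p := by rw [hE]; exact mem_singleton_self _
  have he₀p : e₀ ≠ e_p := ne_of_mem_erase he₀
  have hconst := vsys_const I hD
  -- the virtual chord is ON here
  have horU : (sys I B).orU e_p e_q a = 1 := by
    rcases (by decide : ∀ t : ZMod 2, t = 0 ∨ t = 1) ((sys I B).orU e_p e_q a) with h | h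
    · obtain ⟨hp, hq⟩ := ((sys I B).orU_eq_zero_iff e_p e_q a).1 h
      have := hcorner a hp hq
      rw [ha] at this; exact absurd this zero_ne_one
    · exact h
  by_contra hne
  -- the defect is one of `0, r, r'`
  set d := (sys I B).t + (sys I B).F a + ((1, 0) : V2) with hd
  have hd' : d ≠ V.ρ e₀ 0 + V.ρ' e₀ 0 := by
    intro h
    apply hne
    have e : ∀ t F x y : V2, t + F + x = y → F + (x + y) = t := by decide
    exact e _ _ _ _ h
  obtain ⟨x, hx0, hxval⟩ : ∃ x : ZMod 2 × ZMod 2, x.1 * x.2 = 0 ∧ x.1 • V.ρ e₀ a + x.2 • V.ρ' e₀ a = d := by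
    rw [(hconst e₀ a 0).1, (hconst e₀ a 0).2]
    rcases span_two h1 h2 h3 d with h | h | h | h
    · exact ⟨(0, 0), by simp, by rw [h]; simp⟩
    · exact ⟨(1, 0), by simp, by rw [h]; simp [hV]⟩
    · exact ⟨(0, 1), by simp, by rw [h]; simp [hV]⟩
    · exact absurd h hd'
  -- the state: `e_p` ON, `e₀` in the chosen killed state
  let s : Fin m → ZMod 2 × ZMod 2 := fun e => if e = e_p then (1, 1) else x
  have hsp : s e_p = (1, 1) := if_pos rfl
  have hs₀ : s e₀ = x := if_neg he₀p
  refine vsys_infeasible I hI hT hD a s (fun e he => ?_) ?_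
  · by_cases hep : e = e_p
    · subst hep; rw [hsp, ChordSystem.vsys_u_self, horU]; rfl
    · have : e = e₀ := by
        have : e ∈ (B.N.erase e_q).erase e_p := mem_erase.2 ⟨hep, he⟩
        rw [hE] at this; exact mem_singleton.1 this
      subst this
      rw [hs₀, ChordSystem.vsys_u_of_ne _ _ _ hep, ha]; exact hx0
  · rw [val_pair I hD hE, hsp, hs₀, hxval, one_smul, hd]
    have e : ∀ t F x : V2, F + x + (t + F + x) = t := by decide
    exact e _ _ _

/-- **Both state-free parts are constant on `Z(u_{e₀})`**: `q_{(1,0)} ≡ (r + r')₂` and `q_{(0,1)} ≡ 1 + (r + r')₁` there. -/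
theorem qDir_of_killable (hI : I.IsPure xorAndPred) (hT : Typed I) (hD : CrossData I r B e_p e_q g₀) {e₀ : Fin m} (hE : (B.N.erase e_q).erase e_p = {e₀})
    (h1 : ((sys I B).vsys e_p e_q).ρ e₀ 0 ≠ 0) (h2 : ((sys I B).vsys e_p e_q).ρ' e₀ 0 ≠ 0)
    (h3 : ((sys I B).vsys e_p e_q).ρ e₀ 0 ≠ ((sys I B).vsys e_p e_q).ρ' e₀ 0)
    (hcorner : ∀ a, (sys I B).u e_p a = 0 → (sys I B).u e_q a = 0 → (sys I B).u e₀ a = 1)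
    {a : Fin n → ZMod 2} (ha : (sys I B).u e₀ a = 0) :
    qDir I B (1, 0) a = (((sys I B).vsys e_p e_q).ρ e₀ 0 + ((sys I B).vsys e_p e_q).ρ' e₀ 0).2 ∧
      qDir I B (0, 1) a = 1 + (((sys I B).vsys e_p e_q).ρ e₀ 0 + ((sys I B).vsys e_p e_q).ρ' e₀ 0).1 := by
  have h := F_of_killable I hI hT hD hE h1 h2 h3 hcorner ha
  have hs := congrArg Prod.snd h
  have hf := congrArg Prod.fst h
  simp only [Prod.snd_add, Prod.fst_add] at hs hf
  rw [qDir10_eq I B e_p e_q, qDir01_eq I B e_p e_q, ChordSystem.vsys_F, ChordSystem.vsys_t]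
  refine ⟨?_, ?_⟩
  · have e : ∀ F R t : ZMod 2, F + (0 + R) = t → F + t = R := by decide
    exact e _ _ _ hs
  · have e : ∀ F R t : ZMod 2, F + (1 + R) = t → F + t = 1 + R := by decide
    exact e _ _ _ hf

/-- **On the corner `q_{(1,0)} = (r + r')₂ + 1`**: there `e₀` is ON and the virtual bit is free. -/
theorem qDir10_on_corner (hI : I.IsPure xorAndPred) (hT : Typed I) (hD : CrossData I r B e_p e_q g₀) {e₀ : Fin m}
    (hE : (B.N.erase e_q).erase e_p = {e₀}) (hcorner : ∀ a, (sys I B).u e_p a = 0 → (sys I B).u e_q a = 0 → (sys I B).u e₀ a = 1)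
    {a : Fin n → ZMod 2} (hp : (sys I B).u e_p a = 0) (hq : (sys I B).u e_q a = 0) :
    qDir I B (1, 0) a = (((sys I B).vsys e_p e_q).ρ e₀ 0 + ((sys I B).vsys e_p e_q).ρ' e₀ 0).2 + 1 := by
  classical
  set V := (sys I B).vsys e_p e_q with hV
  have he₀p : e₀ ≠ e_p := by
    have : e₀ ∈ (B.N.erase e_q).erase e_p := by rw [hE]; exact mem_singleton_self _
    exact ne_of_mem_erase this
  have hconst := vsys_const I hD
  have hu₀ := hcorner a hp hq
  have horU : (sys I B).orU e_p e_q a = 0 := ((sys I B).orU_eq_zero_iff e_p e_q a).2 ⟨hp, hq⟩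
  rw [qDir10_eq I B e_p e_q, ← hV]
  have e1 : ∀ F t R : ZMod 2, F + R ≠ t → F + t = R + 1 := by decide
  refine e1 _ _ _ fun hsnd => ?_
  -- choose the virtual bit to fix the first coordinate
  let b : ZMod 2 := V.t.1 + (V.F a).1 + (V.ρ e₀ 0 + V.ρ' e₀ 0).1
  let s : Fin m → ZMod 2 × ZMod 2 := fun e => if e = e_p then (b, 0) else (1, 1)
  have hsp : s e_p = (b, 0) := if_pos rfl
  have hs₀ : s e₀ = (1, 1) := if_neg he₀p
  refine vsys_infeasible I hI hT hD a s (fun e he => ?_) ?_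
  · by_cases hep : e = e_p
    · subst hep; rw [hsp, ChordSystem.vsys_u_self, horU]; exact mul_zero _
    · have : e = e₀ := by
        have : e ∈ (B.N.erase e_q).erase e_p := mem_erase.2 ⟨hep, he⟩
        rw [hE] at this; exact mem_singleton.1 this
      subst this
      rw [hs₀, ChordSystem.vsys_u_of_ne _ _ _ hep, hu₀]; exact mul_one _
  · rw [val_pair I hD hE, hsp, hs₀, one_smul, one_smul, (hconst e₀ a 0).1, (hconst e₀ a 0).2, ← hV]
    refine Prod.ext ?_ ?_
    · simp only [Prod.fst_add, Prod.smul_fst, smul_eq_mul, mul_one]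
      have e2 : ∀ F t R : ZMod 2, F + (t + F + R) + R = t := by decide
      exact e2 _ _ _
    · simp only [Prod.snd_add, Prod.smul_snd, smul_eq_mul, mul_zero, add_zero]
      exact hsnd

/-- **Where `e₀` and the virtual chord are both ON, `F + (1,0) + r + r' ≠ t`.** -/
theorem off_of_forced (hI : I.IsPure xorAndPred) (hT : Typed I) (hD : CrossData I r B e_p e_q g₀) {e₀ : Fin m} (hE : (B.N.erase e_q).erase e_p = {e₀})
    {a : Fin n → ZMod 2} (hu₀ : (sys I B).u e₀ a = 1) (horU : (sys I B).orU e_p e_q a = 1) :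
    (sys I B).F a + (((1, 0) : V2) + (((sys I B).vsys e_p e_q).ρ e₀ 0 + ((sys I B).vsys e_p e_q).ρ' e₀ 0)) ≠ (sys I B).t := by
  classical
  intro h
  have he₀p : e₀ ≠ e_p := by
    have : e₀ ∈ (B.N.erase e_q).erase e_p := by rw [hE]; exact mem_singleton_self _
    exact ne_of_mem_erase this
  have hconst := vsys_const I hD
  let s : Fin m → ZMod 2 × ZMod 2 := fun _ => (1, 1)
  refine vsys_infeasible I hI hT hD a s (fun e he => ?_) ?_
  · by_cases hep : e = e_p
    · subst hep; rw [ChordSystem.vsys_u_self, horU]; exact mul_one _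
    · have : e = e₀ := by
        have : e ∈ (B.N.erase e_q).erase e_p := mem_erase.2 ⟨hep, he⟩
        rw [hE] at this; exact mem_singleton.1 this
      subst this
      rw [ChordSystem.vsys_u_of_ne _ _ _ hep, hu₀]; exact mul_one _
  · rw [val_pair I hD hE, one_smul, one_smul, one_smul, (hconst e₀ a 0).1, (hconst e₀ a 0).2]
    rw [ChordSystem.vsys_t, ← h]
    abel

/-- The prescribed product `u_{e₀} = γ + Q_{D e₀}` satisfies the polar identity with `polar (D e₀)`. -/
theorem u_add (B : BridgeData n m) (e₀ : Fin m) (x w : Fin n → ZMod 2) :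
    (sys I B).u e₀ (x + w) = (sys I B).u e₀ x + (sys I B).u e₀ w + (sys I B).u e₀ 0 +
      polar (B.D e₀) (fun j => I.vars j 2) (fun j => I.vars j 3) x w := by
  rw [sys_u_eq, sys_u_eq, sys_u_eq, sys_u_eq, qform_add']
  have e : ∀ g a b c d : ZMod 2, g + (a + b + c + d) = g + a + (g + b) + (g + c) + d := by decide
  exact e _ _ _ _ _

/-- **Single-quadric classification against `u_{e₀}`** (rank `≥ 4`): a quadratic vanishing on `Z(u_{e₀})` is `0`, `u_{e₀}`, or a product of two affine
functions up to adding `u_{e₀}` — the NOR row of `PstarRankRigidityFour.classification` would make `u_{e₀}` a product plus one, of rank `≤ 2`. -/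
theorem classification_u (hI : I.IsPure xorAndPred) (hS : SimpleOverlap I) (hB : BoundaryExpanding r I) (hD : CrossData I r B e_p e_q g₀) {e₀ : Fin m}
    (he₀ : e₀ ∈ B.N) {g : (Fin n → ZMod 2) → ZMod 2} (hg : IsQuadFn g) (hZ : ∀ x, (sys I B).u e₀ x = 0 → g x = 0) :
    ((∀ x, g x = 0) ∨ (∀ x, g x = (sys I B).u e₀ x)) ∨
    (∃ μ₁ μ₂ : (Fin n → ZMod 2) → ZMod 2, IsAffineFn μ₁ ∧ IsAffineFn μ₂ ∧
      ((∀ x, g x = μ₁ x * μ₂ x) ∨ (∀ x, (sys I B).u e₀ x + g x = μ₁ x * μ₂ x))) := by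
  have hJr : B.J₀.card ≤ r := le_trans (card_le_card (subset_union_left.trans subset_union_left)) hD.rad
  have hrank := rank_four_of_wf I hI hS hB hD.wf hJr he₀
  have hu := u_add I B e₀
  rcases classification hu (exists_ne_of_rank_four hu hrank) hg hZ with h | h | ⟨a, b, hab, hq, -⟩
  · exact Or.inl h
  · exact Or.inr h
  · exfalso
    set P : LinearMap.BilinForm (ZMod 2) (Fin n → ZMod 2) := polar (B.D e₀) (fun j => I.vars j 2) (fun j => I.vars j 3) with hP
    have hμ : ∀ c : Fin n → ZMod 2, IsAffineFn (fun x => P x c + ((sys I B).u e₀ c + (sys I B).u e₀ 0)) := by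
      intro c x w
      show P (x + w) c + _ = P x c + _ + (P w c + _) + (P 0 c + _)
      rw [P.map_add, LinearMap.add_apply, P.map_zero, LinearMap.zero_apply]
      have e : ∀ p q k : ZMod 2, p + q + k = p + k + (q + k) + (0 + k) := by decide
      exact e _ _ _
    exact not_rank_four_of_mul hu (hμ b) (hμ a) (κ := 1) hq hrank

/-- `q_{(1,0)} + κ` and `q_{(0,1)} + κ` are quadratic. -/
theorem isQuadFn_qDir (B : BridgeData n m) (mv : V2) (κ : ZMod 2) : IsQuadFn fun x : Fin n → ZMod 2 => qDir I B mv x + κ :=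
  ⟨polarDir I B mv, fun x w => by
    show qDir I B mv (x + w) + κ = qDir I B mv x + κ + (qDir I B mv w + κ) + (qDir I B mv 0 + κ) + polarDir I B mv x w
    rw [qDir_add]
    have e : ∀ a b c d k : ZMod 2, a + b + c + d + k = a + k + (b + k) + (c + k) + d := by decide
    exact e _ _ _ _ _⟩

/-- **U2: the three rows for `q_{(1,0)}`** — constant, `u_{e₀} +` constant, or a product shape. -/
theorem qDir10_cases (hI : I.IsPure xorAndPred) (hT : Typed I) (hS : SimpleOverlap I) (hB : BoundaryExpanding r I) (hD : CrossData I r B e_p e_q g₀)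
    {e₀ : Fin m} (hE : (B.N.erase e_q).erase e_p = {e₀})
    (h1 : ((sys I B).vsys e_p e_q).ρ e₀ 0 ≠ 0) (h2 : ((sys I B).vsys e_p e_q).ρ' e₀ 0 ≠ 0)
    (h3 : ((sys I B).vsys e_p e_q).ρ e₀ 0 ≠ ((sys I B).vsys e_p e_q).ρ' e₀ 0)
    (hcorner : ∀ a, (sys I B).u e_p a = 0 → (sys I B).u e_q a = 0 → (sys I B).u e₀ a = 1) :
    let κ := (((sys I B).vsys e_p e_q).ρ e₀ 0 + ((sys I B).vsys e_p e_q).ρ' e₀ 0).2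
    ((∀ x, qDir I B (1, 0) x + κ = 0) ∨ (∀ x, qDir I B (1, 0) x + κ = (sys I B).u e₀ x)) ∨
    (∃ μ₁ μ₂ : (Fin n → ZMod 2) → ZMod 2, IsAffineFn μ₁ ∧ IsAffineFn μ₂ ∧
      ((∀ x, qDir I B (1, 0) x + κ = μ₁ x * μ₂ x) ∨ (∀ x, (sys I B).u e₀ x + (qDir I B (1, 0) x + κ) = μ₁ x * μ₂ x))) := by
  intro κ
  have he₀ : e₀ ∈ B.N := by
    have : e₀ ∈ (B.N.erase e_q).erase e_p := by rw [hE]; exact mem_singleton_self _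
    exact mem_of_mem_erase (mem_of_mem_erase this)
  refine classification_u I hI hS hB hD he₀ (isQuadFn_qDir I B (1, 0) κ) fun x hx => ?_
  rw [(qDir_of_killable I hI hT hD hE h1 h2 h3 hcorner hx).1]
  exact CharTwo.add_self_eq_zero _

/-- **U2: the three rows for `q_{(0,1)}`.** -/
theorem qDir01_cases (hI : I.IsPure xorAndPred) (hT : Typed I) (hS : SimpleOverlap I) (hB : BoundaryExpanding r I) (hD : CrossData I r B e_p e_q g₀)
    {e₀ : Fin m} (hE : (B.N.erase e_q).erase e_p = {e₀})
    (h1 : ((sys I B).vsys e_p e_q).ρ e₀ 0 ≠ 0) (h2 : ((sys I B).vsys e_p e_q).ρ' e₀ 0 ≠ 0)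
    (h3 : ((sys I B).vsys e_p e_q).ρ e₀ 0 ≠ ((sys I B).vsys e_p e_q).ρ' e₀ 0)
    (hcorner : ∀ a, (sys I B).u e_p a = 0 → (sys I B).u e_q a = 0 → (sys I B).u e₀ a = 1) :
    let κ := 1 + (((sys I B).vsys e_p e_q).ρ e₀ 0 + ((sys I B).vsys e_p e_q).ρ' e₀ 0).1
    ((∀ x, qDir I B (0, 1) x + κ = 0) ∨ (∀ x, qDir I B (0, 1) x + κ = (sys I B).u e₀ x)) ∨
    (∃ μ₁ μ₂ : (Fin n → ZMod 2) → ZMod 2, IsAffineFn μ₁ ∧ IsAffineFn μ₂ ∧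
      ((∀ x, qDir I B (0, 1) x + κ = μ₁ x * μ₂ x) ∨ (∀ x, (sys I B).u e₀ x + (qDir I B (0, 1) x + κ) = μ₁ x * μ₂ x))) := by
  intro κ
  have he₀ : e₀ ∈ B.N := by
    have : e₀ ∈ (B.N.erase e_q).erase e_p := by rw [hE]; exact mem_singleton_self _
    exact mem_of_mem_erase (mem_of_mem_erase this)
  refine classification_u I hI hS hB hD he₀ (isQuadFn_qDir I B (0, 1) κ) fun x hx => ?_
  rw [(qDir_of_killable I hI hT hD hE h1 h2 h3 hcorner hx).2]
  exact CharTwo.add_self_eq_zero _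

end

end Summit.PneNP.PneNP.Theorems.PstarCrossCaseU2
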